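import Summits.QuantumFields.BalabanUV.T4Continuum.Spine.NE2BalabanWiring
import Summits.QuantumFields.BalabanUV.T4Continuum.Support.NestedContourTransportBound

/-!
# T⁴ programme, spine node NE2 (U1a), tier B row B8 «general rate» (owner ruling R17 (c)), PART 2 — THE TRANSPORT-AVERAGING SUMMAND
# (row B3's `hE` binder of ROOT B) AT A GENERAL GEOMETRIC RATE `θ ∈ [L⁻¹, 1)`

NE2 formalisation swarm `b2b-balaban-t4-ne2-formalise-*`, leaf prover 08 (gen 2; rows B7 / B6′ lineage; author of the located currency gap
GAPS `G-ne2leaf08g2-1` whose closer (M1′) «ROOT B at a general rate» the owner SPLIT in ruling R17 (c): ENGINE half = the owner's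
`Spine/NE2ColourPerturbedLayerRate` (p216739), STRUCTURE half = row B8, taken part by part by the leaves — part 1 (the covariant-Laplacian slot,
rows B2/B5) is leaf-07-g3's, THIS is part 2; INTENT CLAIMS.log 2026-08-20).  Inputs BY NAME: row B6's ALREADY RATE-GENERIC read-out
`NE2FromNE3.consistent_of_localRate` (`LocalRate … C θ ⟹ ‖W^{(k+1)}(x′) − W^{(k)}(par x′)‖ ≤ card o·2C·θ^k`), leaf-06's two-level
contour law `NestedContourTransport.transport_contour_two_level` (explicit constant `thetaC L n d a′ a b`, the per-bond connection consistency `b` FREE) and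
its closed form `thetaC_le_theta0_div` (`θ₀(d, α, β)/n` at `b = β/(L·n²)`), leaf-07's rate-generic `CovariantBlockAveraging.averagingLaws_Ecov`
(any defect sequence) and `averagingLaws_mono`, leaf-03's per-bond forms `norm_transporter_sub_one_le` / `norm_transporter_succ_sub_one_le`,
and the rate-`L⁻¹` instance of record `RegularTransportersContour.{perBond_consistency_of_localRate, transport_contour_two_level_of_regular}`,
`NE2BalabanWiring.{thetaR, epsR, CdeltaR, averagingLaws_Ecov_of_regular}`, `NE2BalabanFinal.thetaR_le_geom` — which this file RE-TYPES at
rate `θ` WITHOUT editing (append-only twin; the instance of record is the case `θ = L⁻¹`, `thetaC_invRate_eq_thetaR`).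

WHAT THIS FILE PROVES (bookkeeping; no new estimate):
 * §1 **`perBond_consistency_of_localRate_rate`**: `LocalRate (bgReadings (regClass R)) C θ` (θ ≥ 0) gives leaf-06's per-bond consistency
   hypothesis at the tower levels with `b_k = βNE3(C)·θ^k/(L·n_k)` (`βNE3 = 2·card o·C`; at `θ = L⁻¹` this is leaf-03's `βNE3/(L·n_k²)`);
 * §2 **`transport_contour_two_level_of_regular_rate`**: hence, from `(hreg : RegularTransporters L M R α β)` and `(hNE3θ : LocalRate … C θ)`
   DISPLAYED, the refined/parent contour transporters of `R^{(k+1)}`/`R^{(k)}` differ by at most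
   `thetaC L n_k d (α/(L n_k)) (α/n_k) (βNE3·θ^k/(L n_k))` (leaf-06's constant at the rate-θ consistency; no new definition);
 * §3 **`thetaC_rate_le_geom`**: `thetaC L n_k d (α/(L n_k)) (α/n_k) (βNE3·θ^k/(L n_k)) ≤ theta0 d α (βNE3 C)·θ^k` for `L⁻¹ ≤ θ` — the SAME
   closed-form constant `theta0` as the rate-`L⁻¹` bound `thetaR_le_geom`, obtained WITHOUT re-running leaf-06's estimate: SCALING
   `βNE3·θ^k/(L n_k) = (βNE3·s)/(L n_k²)` with
   `s = θ^k·n_k ≥ 0`, leaf-06's `thetaC_le_theta0_div` VERBATIM at `β ← βNE3·s`, then `theta0 d α β = theta0 d α 0 + B(d, α)·β` is AFFINE in `β`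
   (`theta0_eq_affine`) and `n_k⁻¹ = L⁻¹^k ≤ θ^k`;
 * §4 **`averagingLaws_Ecov_rate`** (leaf-07's `averagingLaws_Ecov_geom` with majorant `ϑ_k ≤ θ₀·ρ^k`, `L⁻¹ ≤ ρ`; the size term
   `τ/n_k = τ·L⁻¹^k ≤ τ·ρ^k`; SAME `Cδ = Cst·card o·(θ₀ + τ)`) and the PART-2 END **`averagingLaws_Ecov_of_regular_rate (hreg) (hC)
   (hθ : L⁻¹ ≤ θ) (hNE3θ) : AveragingLaws (Δ_a ⊗ 1) (Ecov L M R) (J ⊗ 1) (epsR o d α) (k ↦ CdeltaR o d a α (theta0 d α (βNE3 C))·θ^k)`**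
   — row B3's `hE` binder of ROOT B (`averagingLaws_Ecov_of_regular` ∘ `thetaR_le_geom`) with node NE3's `LocalRate` ALLOWED AT ANY
   `θ ∈ [L⁻¹, 1)` and EVERY constant (`epsR`, `CdeltaR`, `theta0`) UNCHANGED, so that part 4's `perturbationLaws_balaban_final_rate` can feed
   the rate-generic Gram core with the same letters; `averagingLaws_Ecov_of_regular_invRate` records that at `θ = L⁻¹` it IS the instance
   of record's datum;
 * §5 the SLOT FORM: **`perturbationLaws_covariantAveraging_balaban_rate`** (leaf-01's B3.b-inst END with `hE` at rate `ρ ≥ L⁻¹`, the free datum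
   `hB` majorised; SAME `κ_Q`, `C₂^Q`) and **`perturbationLaws_avgPert_of_regular_rate (hreg) (hC) (hθ) (hNE3θ) : PerturbationLaws (Δ_a ⊗ 1)
   (NE2BalabanRoot.avgPert L M a R) (J ⊗ 1) (kappaQ d a a (epsR o d α)) (k ↦ a·C2gram Cst 1 (epsR …) (2dCst) CJ Cst (CdeltaR … (theta0 …))·θ^k)`**
   — EXACTLY the `hP₃` slot of `NE2BalabanLayer.perturbationLaws_add₃` in the instance of record, at rate `θ`: part 4 sums it with part 1's
   B2/B5 slot and part 3's gauge slot and feeds the owner's `towerLimitRate_perturbed_king_kron_rate`.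

HONEST FRAMING (T4-DAG p. 1).  MODEL LEVEL (transporters `R` are DATA; GLOBAL small field; no assertion that they are Bałaban's minimisers —
no dictionary B0, c5); node NE3's `LocalRate` is a DISPLAYED binder consumed BY NAME (c2/c7) — nothing of NE3 is proved, and whether NE3
can supply sup currency at some `θ > L⁻¹` is exactly the open content side of G-ne2leaf08g2-1 ((M3′), the step-Lipschitz input); finite
torus, operator norm; constants OURS; NOT [B9] (3.19)/(3.26) as printed; the instance of record (`θ = L⁻¹`) is neither edited nor superseded;
**NE2 (U1a) NOT PROVED**; spine PROVED 0/9 unchanged; NOT infinite volume, NOT a mass gap, NOT Clay.  HONEST DEPENDENCY: continuum YM on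
T⁴ ⇐ BetaPertH ∧ nine spine estimates (0/9 proved); BetaPertH ⇐ (D1) ∧ (D4) ∧ CAP+tail; G-an2-4 gates asym, D1 and NE2/3/4.  ABSOLUTE RULE:
no internally-minted statement enters as a cited fact; no `def … : Prop` fact; no new definition; no `sorry`.
-/

noncomputable section

open scoped BigOperators ComplexConjugate Matrix Matrix.Norms.L2Operator Kronecker

namespace Summit.QuantumFields.BalabanUV.T4Continuum.AveragingSummandRate

open Literature.MathematicalPhysics.QuantumFieldTheory.Balaban1983to89.B5Prop11Plancherel (Cst Cst_nonneg Tor fine)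
open Literature.MathematicalPhysics.QuantumFieldTheory.Balaban1983to89.B5G183RateUnitTower (lev lev_neZero)
open Literature.MathematicalPhysics.QuantumFieldTheory.Balaban1983to89.T4EtaRateMin (LocalRate)
open Summit.QuantumFields.BalabanUV.T4Continuum
open Summit.QuantumFields.BalabanUV.T4Continuum.BalabanAveragedTowerModes (par)
open Summit.QuantumFields.BalabanUV.T4Continuum.BalabanAveragedTowerUnit (idx one_le_lev' cast_lev' lev_succ')
open Summit.QuantumFields.BalabanUV.T4Continuum.BlockPairingGeometry
open Summit.QuantumFields.BalabanUV.T4Continuum.KingPairingPlantedLaw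
open Summit.QuantumFields.BalabanUV.T4Continuum.GramPerturbationLaw (AveragingLaws)
open Summit.QuantumFields.BalabanUV.T4Continuum.NE2FromNE3 (bgReadings consistent_of_localRate)
open Summit.QuantumFields.BalabanUV.T4Continuum.CovariantBlockAveraging (transport contour ctr Ecov averagingLaws_Ecov averagingLaws_mono
  norm_ctr_sub_one_le)
open Summit.QuantumFields.BalabanUV.T4Continuum.LineAveragingPairing (glue)
open Summit.QuantumFields.BalabanUV.T4Continuum.NestedContourTransport (thetaC ThetaC_nonneg xiC_nonneg one_le_Bl theta0
  transport_contour_two_level consistency_div thetaC_le_theta0_div)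
open Summit.QuantumFields.BalabanUV.T4Continuum.RegularBackgroundTower
open Summit.QuantumFields.BalabanUV.T4Continuum.RegularTransportersPerBond (norm_transporter_sub_one_le)
open Summit.QuantumFields.BalabanUV.T4Continuum.RegularTransportersContour (cast_lev_succ norm_transporter_succ_sub_one_le)
open Summit.QuantumFields.BalabanUV.T4Continuum.NE2BalabanWiring (thetaR epsR CdeltaR epsR_nonneg)
open Summit.QuantumFields.BalabanUV.T4Continuum.BackgroundResolventTower
open Summit.QuantumFields.BalabanUV.T4Continuum.PerturbationAlgebra (perturbationLaws_mono)
open Summit.QuantumFields.BalabanUV.T4Continuum.KroneckerLift (freeTowerLaws_kron)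
open Summit.QuantumFields.BalabanUV.T4Continuum.NE2PerturbedLayer (freeTowerLaws_king)
open Summit.QuantumFields.BalabanUV.T4Continuum.NE2ColourPerturbedLayer (opNorm_inv_calDalev_kron_le)
open Summit.QuantumFields.BalabanUV.T4Continuum.GramPerturbationLaw (C2gram perturbationLaws_gramPert e2gram_le_geom)
open Summit.QuantumFields.BalabanUV.T4Continuum.CovariantAveragingSummand (kappaQ)
open Summit.QuantumFields.BalabanUV.T4Continuum.CovariantBlockAveraging (Bfree QcovLev)
open Summit.QuantumFields.BalabanUV.T4Continuum.CovariantAveragingBalaban (gramPert_Bfree_Ecov)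
open Summit.QuantumFields.BalabanUV.T4Continuum.LineAveragingPairing (averagingLaws_Bfree)
open Summit.QuantumFields.BalabanUV.T4Continuum.NE2BalabanRoot (avgPert)
open Literature.MathematicalPhysics.QuantumFieldTheory.Balaban1983to89.B5Block118 (QvOp)

variable {d : ℕ} (L : ℕ) [NeZero L] (M : Fin d → ℕ) [hM : ∀ μ, NeZero (M μ)] (a : ℝ) (ha : 0 < a)
variable {o : Type*} [Fintype o] [DecidableEq o]
variable {R : (k : ℕ) → Fin d → (idx L M k → Matrix o o ℂ)} {α β : ℝ}

/-! ## §1 The per-bond connection consistency from node NE3 at rate `θ` -/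

/-- **THE PER-BOND CONNECTION CONSISTENCY FROM NODE NE3 BY NAME, AT RATE `θ`**: `LocalRate (bgReadings (regClass R)) C θ` (`θ ≥ 0`; row B6's
rate-generic `NE2FromNE3.consistent_of_localRate`, read on the connection tower `w = L^k(R − 1) ∈ regClass R`) gives leaf-06's hypothesis `hC` at
the levels `n_k ← L·n_k` with `b_k = βNE3·θ^k/(L·n_k)`:
`‖(R^{(k+1)}_ν(x′, κ) − 1) − L⁻¹·(R^{(k)}_ν(par x′, κ) − 1)‖ ≤ βNE3(C)·θ^k/(L·n_k)`.  At `θ = L⁻¹` this is leaf-03's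
`perBond_consistency_of_localRate` (`βNE3/(L·n_k²)`).  Nothing of NE3 is proved: `hNE3θ` is a displayed binder. [folklore] -/
theorem perBond_consistency_of_localRate_rate {C θ : ℝ} (hC : 0 ≤ C) (hθ0 : 0 ≤ θ)
    (hNE3θ : LocalRate (bgReadings L M (regClass L M R)) C θ)
    (k : ℕ) (ν : Fin d) (x' : Tor (fine (L * lev L k) M)) (κ : Fin d) :
    ‖(R (k + 1) ν (x', κ) - 1) - ((L : ℂ))⁻¹ • (R k ν (par (lev L k) L M x', κ) - 1)‖
      ≤ betaNE3 o C * θ ^ k / ((L : ℝ) * (lev L k : ℕ)) := by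
  have hw := consistent_of_localRate L M hC hθ0 hNE3θ (Set.mem_insert _ _ : connTower L M R ∈ regClass L M R) k ν (x', κ)
  rw [connTower_eq, connTower_eq] at hw
  have hne : ((lev L (k + 1) : ℕ) : ℂ) ≠ 0 := by exact_mod_cast (NeZero.ne (lev L (k + 1)))
  have hc' : ((lev L (k + 1) : ℕ) : ℂ) = (L : ℂ) * ((lev L k : ℕ) : ℂ) := by rw [lev_succ', Nat.cast_mul]
  have h := consistency_div L hc' hne (R (k + 1) ν (x', κ)) (R k ν (par (lev L k) L M x', κ)) hw
  refine h.trans (le_of_eq ?_)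
  rw [Complex.norm_natCast, cast_lev_succ, betaNE3]
  ring

/-! ## §2 The two-level contour law at rate `θ` -/

/-! The two-level consistency constant of the contour transporters at rate `θ` is leaf-06's `thetaC` at leaf-03's size arguments and §1's
consistency, `thetaC L n_k d (α/(L n_k)) (α/n_k) (βNE3(C)·θ^k/(L n_k))` — written out in full below (no new definition; at `θ = L⁻¹` it is
`NE2BalabanWiring.thetaR o d L α C k`). -/

omit hM [DecidableEq o] in
/-- **THE INSTANCE OF RECORD IS THE CASE `θ = L⁻¹`**: at `θ = L⁻¹` the rate-`θ` consistency constant IS `NE2BalabanWiring.thetaR o d L α C k`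
(`βNE3·L⁻¹^k/(L n_k) = βNE3/(L n_k²)`, `n_k = L^k`). [folklore] -/
theorem thetaC_invRate_eq_thetaR (α C : ℝ) (k : ℕ) :
    thetaC L (lev L k) d (α / ((L : ℝ) * (lev L k : ℕ))) (α / (lev L k : ℕ)) (betaNE3 o C * ((L : ℝ)⁻¹) ^ k / ((L : ℝ) * (lev L k : ℕ)))
      = thetaR o d L α C k := by
  have hL : (L : ℝ) ≠ 0 := by exact_mod_cast (NeZero.ne L)
  have hn : ((lev L k : ℕ) : ℝ) ≠ 0 := (lev_pos L k).ne'
  unfold thetaR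
  congr 1
  rw [inv_pow, ← cast_lev']
  field_simp

omit [NeZero L] hM [DecidableEq o] in
/-- the rate-`θ` consistency constant is `≥ 0` for `α, C, θ ≥ 0`. [folklore] -/
theorem thetaC_rate_nonneg {α C θ : ℝ} (hα : 0 ≤ α) (hC : 0 ≤ C) (hθ0 : 0 ≤ θ) (k : ℕ) :
    0 ≤ thetaC L (lev L k) d (α / ((L : ℝ) * (lev L k : ℕ))) (α / (lev L k : ℕ)) (betaNE3 o C * θ ^ k / ((L : ℝ) * (lev L k : ℕ))) := by
  have ha' : 0 ≤ α / ((L : ℝ) * (lev L k : ℕ)) := by positivity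
  have ha1 : 0 ≤ α / (lev L k : ℕ) := by positivity
  have hb : 0 ≤ betaNE3 o C * θ ^ k / ((L : ℝ) * (lev L k : ℕ)) := by unfold betaNE3; positivity
  have hB := one_le_Bl (L := L) (n := lev L k) ha' ha1
  have hT := ThetaC_nonneg (L := L) (n := lev L k) ha' ha1 hb
  have hx := xiC_nonneg (L := L) ha'
  unfold thetaC
  exact mul_nonneg (pow_nonneg (zero_le_one.trans hB) _)
    (add_nonneg (add_nonneg (mul_nonneg (by positivity) hT) (mul_nonneg zero_le_two hx)) ha1)

/-- **ROW B3.b-conc (ii)'s TWO-LEVEL LAW AT THE TOWER LEVELS, FROM THE REGULARITY CLASS AND NODE NE3 AT RATE `θ`** (leaf-06's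
`transport_contour_two_level` with `R′ = R^{(k+1)}`, `R = R^{(k)}`, `n = n_k`, `b = βNE3·θ^k/(L n_k)`): for every block base `y`, colour slot
`μ`, coarse offset `j`, sub-block offset `r` and `t′ < L·n_k`, the refined-contour and parent-contour transporters differ by at most
`thetaC L n_k d (α/(L n_k)) (α/n_k) (βNE3·θ^k/(L n_k))`.  Binders `hreg` (row B5's (3.35)-shape class) and `hNE3θ` (node NE3's
`LocalRate` at rate `θ`, OPEN, consumed by name) DISPLAYED; NE2 is NOT proved by this. [folklore] -/
theorem transport_contour_two_level_of_regular_rate (hreg : RegularTransporters L M R α β) {C θ : ℝ} (hC : 0 ≤ C) (hθ0 : 0 ≤ θ)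
    (hNE3θ : LocalRate (bgReadings L M (regClass L M R)) C θ) (k : ℕ) (y : Tor M) (μ : Fin d)
    (j : Fin d → Fin (lev L k)) (r : Fin d → Fin L) (t' : ℕ) (ht' : t' < L * lev L k) :
    ‖transport (fine (L * lev L k) M) (R (k + 1)) μ (contour (L * lev L k) M y (glue (lev L k) L (j, r)) μ t')
        - transport (fine (lev L k) M) (R k) μ (contour (lev L k) M y j μ (((r μ : ℕ) + t') / L))‖
      ≤ thetaC L (lev L k) d (α / ((L : ℝ) * (lev L k : ℕ))) (α / (lev L k : ℕ)) (betaNE3 o C * θ ^ k / ((L : ℝ) * (lev L k : ℕ))) := by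
  obtain ⟨hα, hβ⟩ := hreg.nonneg
  have hb : 0 ≤ betaNE3 o C * θ ^ k / ((L : ℝ) * (lev L k : ℕ)) := by unfold betaNE3; positivity
  exact transport_contour_two_level (lev L k) L M (by positivity) (by positivity) hb
    (fun ν i => norm_transporter_succ_sub_one_le hreg k ν i) (fun ν i => norm_transporter_sub_one_le hreg k ν i)
    (fun ν x' κ => perBond_consistency_of_localRate_rate L M hC hθ0 hNE3θ k ν x' κ) y μ j r t' ht'

/-! ## §3 The numeric geometric bound at rate `θ`, with the SAME closed-form constant `theta0` -/

/-- `theta0` is AFFINE in the consistency constant: `theta0 d α β = theta0 d α 0 + e^{2(d+1)α}·(d+1)·e^{4α}·β`. [folklore] -/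
theorem theta0_eq_affine (d : ℕ) (α β : ℝ) :
    theta0 d α β = theta0 d α 0 + Real.exp (2 * (d + 1) * α) * ((d + 1) * Real.exp (4 * α)) * β := by
  unfold theta0; ring

/-- `theta0 d α 0 ≥ 0` for `α ≥ 0`. [folklore] -/
theorem theta0_zero_nonneg (d : ℕ) {α : ℝ} (hα : 0 ≤ α) : 0 ≤ theta0 d α 0 := by
  unfold theta0; positivity

omit hM [DecidableEq o] in
/-- **THE RATE-`θ` CONSISTENCY CONSTANT IS `≤ θ₀·θ^k` WITH THE CONSTANT OF RECORD** (`L⁻¹ ≤ θ`, `α, C ≥ 0`):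
`thetaC L n_k d (α/(L n_k)) (α/n_k) (βNE3·θ^k/(L n_k)) ≤ theta0 d α (βNE3 C)·θ^k` — leaf-06's `thetaC_le_theta0_div` at `β ← βNE3·s`,
`s = θ^k·n_k` (so that `βNE3·θ^k/(L n_k) = (βNE3·s)/(L n_k²)`), then `theta0` affine in `β` and `n_k⁻¹ = L⁻¹^k ≤ θ^k`.  At `θ = L⁻¹` this
is `NE2BalabanFinal.thetaR_le_geom` (via `thetaC_invRate_eq_thetaR`). [folklore] -/
theorem thetaC_rate_le_geom {α C θ : ℝ} (hα : 0 ≤ α) (hC : 0 ≤ C) (hθ : ((L : ℝ)⁻¹) ≤ θ) (k : ℕ) :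
    thetaC L (lev L k) d (α / ((L : ℝ) * (lev L k : ℕ))) (α / (lev L k : ℕ)) (betaNE3 o C * θ ^ k / ((L : ℝ) * (lev L k : ℕ)))
      ≤ theta0 d α (betaNE3 o C) * θ ^ k := by
  have hL1 : 1 ≤ L := Nat.pos_of_ne_zero (NeZero.ne L)
  have hLr : (0 : ℝ) < L := by exact_mod_cast hL1
  have hn : (0 : ℝ) < (lev L k : ℕ) := lev_pos L k
  have hL0 : (0 : ℝ) ≤ (L : ℝ)⁻¹ := inv_nonneg.mpr hLr.le
  have hθ0 : 0 ≤ θ := hL0.trans hθ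
  have hb : 0 ≤ betaNE3 o C := by unfold betaNE3; positivity
  -- `n_k⁻¹ ≤ θ^k`
  have hinv : ((lev L k : ℕ) : ℝ)⁻¹ ≤ θ ^ k := by
    rw [cast_lev', ← inv_pow]; exact pow_le_pow_left₀ hL0 hθ k
  -- the scaling `βNE3·θ^k/(L n_k) = (βNE3·s)/(L n_k²)`, `s = θ^k·n_k`
  set s : ℝ := θ ^ k * ((lev L k : ℕ) : ℝ) with hs
  have hs0 : 0 ≤ s := by positivity
  have hbs : 0 ≤ betaNE3 o C * s := mul_nonneg hb hs0
  have e : betaNE3 o C * θ ^ k / ((L : ℝ) * (lev L k : ℕ)) = betaNE3 o C * s / ((L : ℝ) * ((lev L k : ℕ) : ℝ) ^ 2) := by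
    rw [hs]; field_simp
  have hsn : s / ((lev L k : ℕ) : ℝ) = θ ^ k := by rw [hs]; field_simp
  have h := thetaC_le_theta0_div hL1 (one_le_lev' L k) d hα hbs
  rw [e]
  refine h.trans ?_
  rw [theta0_eq_affine d α (betaNE3 o C * s), theta0_eq_affine d α (betaNE3 o C)]
  have hA := theta0_zero_nonneg d hα
  have hB : 0 ≤ Real.exp (2 * (d + 1) * α) * ((d + 1) * Real.exp (4 * α)) := by positivity
  have hBb : 0 ≤ Real.exp (2 * (d + 1) * α) * ((d + 1) * Real.exp (4 * α)) * betaNE3 o C := mul_nonneg hB hb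
  calc (theta0 d α 0 + Real.exp (2 * (d + 1) * α) * ((d + 1) * Real.exp (4 * α)) * (betaNE3 o C * s)) / ((lev L k : ℕ) : ℝ)
      = theta0 d α 0 * ((lev L k : ℕ) : ℝ)⁻¹
          + Real.exp (2 * (d + 1) * α) * ((d + 1) * Real.exp (4 * α)) * betaNE3 o C * (s / ((lev L k : ℕ) : ℝ)) := by
        rw [div_eq_mul_inv, div_eq_mul_inv]; ring
    _ ≤ theta0 d α 0 * θ ^ k + Real.exp (2 * (d + 1) * α) * ((d + 1) * Real.exp (4 * α)) * betaNE3 o C * θ ^ k := by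
        rw [hsn]; exact add_le_add (mul_le_mul_of_nonneg_left hinv hA) le_rfl
    _ = (theta0 d α 0 + Real.exp (2 * (d + 1) * α) * ((d + 1) * Real.exp (4 * α)) * betaNE3 o C) * θ ^ k := by ring

/-! ## §4 The `E`-datum of the Gram law at rate `ρ`, and the part-2 END -/

/-- **GEOMETRIC FORM AT RATE `ρ`** (leaf-07's `averagingLaws_Ecov_geom` with `L⁻¹ ≤ ρ`): if the transporter consistency obeys `ϑ_k ≤ θ₀·ρ^k`,
then `AveragingLaws … (Ecov L M R) … ε (k ↦ Cδ·ρ^k)` with the SAME `Cδ = Cst·card o·(θ₀ + τ)` — the size term `τ/n_k = τ·L⁻¹^k` is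
majorised by `τ·ρ^k`. [cite: Balaban1984PropagatorsI, Prop. 1.1 (1.89) p.33 (‖Δ_a⁻¹‖ ≤ Cst)] [folklore] -/
theorem averagingLaws_Ecov_rate {α τ θ₀ ρ : ℝ} {ϑ : ℕ → ℝ} (hα : 0 ≤ α)
    (hR : ∀ k ν i, ‖R k ν i - 1‖ ≤ α / (lev L k : ℕ)) (hϑ : ∀ k, 0 ≤ ϑ k) (hτ : 0 ≤ τ) (hρ : ((L : ℝ)⁻¹) ≤ ρ)
    (hϑg : ∀ k, ϑ k ≤ θ₀ * ρ ^ k)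
    (hT2 : ∀ (k : ℕ) (y : Tor M) (μ : Fin d) (j : Fin d → Fin (lev L k)) (r : Fin d → Fin L) (t' : ℕ), t' < L * lev L k →
      ‖ctr M (L * lev L k) (R (k + 1)) y (glue (lev L k) L (j, r)) μ t' - ctr M (lev L k) (R k) y j μ (((r μ : ℕ) + t') / L)‖ ≤ ϑ k)
    (hTτ : ∀ (k : ℕ) (y : Tor M) (μ : Fin d) (j : Fin d → Fin (lev L k)) (s : ℕ), s ≤ lev L k →
      ‖ctr M (lev L k) (R k) y j μ s - 1‖ ≤ τ) :
    AveragingLaws (fun k => calDalev L M a ha k ⊗ₖ (1 : Matrix o o ℂ)) (Ecov L M R) (fun k => JpcT L M k ⊗ₖ (1 : Matrix o o ℂ))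
      (Fintype.card o * (Real.exp ((d + 1 : ℕ) * α) - 1)) (fun k => (Cst d a * Fintype.card o * (θ₀ + τ)) * ρ ^ k) := by
  refine averagingLaws_mono (averagingLaws_Ecov L M a ha hα hR hϑ hτ hT2 hTτ) fun k => ?_
  have hlev : (τ / (lev L k : ℕ) : ℝ) = τ * ((L : ℝ)⁻¹) ^ k := by rw [cast_lev', inv_pow, div_eq_mul_inv]
  rw [hlev]
  have hC := Cst_nonneg d a
  have hL0 : (0 : ℝ) ≤ (L : ℝ)⁻¹ := inv_nonneg.mpr (Nat.cast_nonneg L)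
  have hτk : τ * ((L : ℝ)⁻¹) ^ k ≤ τ * ρ ^ k := mul_le_mul_of_nonneg_left (pow_le_pow_left₀ hL0 hρ k) hτ
  calc Cst d a * (Fintype.card o * (ϑ k + τ * ((L : ℝ)⁻¹) ^ k))
      ≤ Cst d a * (Fintype.card o * (θ₀ * ρ ^ k + τ * ρ ^ k)) :=
        mul_le_mul_of_nonneg_left (mul_le_mul_of_nonneg_left (add_le_add (hϑg k) hτk) (Nat.cast_nonneg _)) hC
    _ = (Cst d a * Fintype.card o * (θ₀ + τ)) * ρ ^ k := by ring

/-- **ROW B8 PART 2 END — THE `hE` BINDER OF ROOT B FROM THE REGULARITY CLASS AND NODE NE3 AT A GENERAL RATE `θ ≥ L⁻¹`**: for transporters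
in row B5's class whose coefficient towers `{w, Dw}` obey node NE3's `LocalRate … C θ`, `AveragingLaws (Δ_a ⊗ 1) (Ecov L M R) (J ⊗ 1) ε (Cδ·θ^k)`
with `ε = epsR o d α`, `Cδ = CdeltaR o d a α (theta0 d α (βNE3 C))` — EVERY LETTER AS IN THE INSTANCE OF RECORD
(`NE2BalabanWiring.averagingLaws_Ecov_of_regular` with `NE2BalabanFinal.thetaR_le_geom`), the rate alone moved from `L⁻¹` to `θ`.  `hNE3θ` is
a displayed binder (node NE3 OPEN; whether it can supply sup currency at `θ > L⁻¹` is the open content side of G-ne2leaf08g2-1); `θ < 1` is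
not needed here (it enters at the engine, part 4); NE2 is NOT proved by this. [cite: Balaban1985BackgroundPropagators, (3.19) p.393 (shape)]
[folklore] -/
theorem averagingLaws_Ecov_of_regular_rate (hreg : RegularTransporters L M R α β) {C θ : ℝ} (hC : 0 ≤ C) (hθ : ((L : ℝ)⁻¹) ≤ θ)
    (hNE3θ : LocalRate (bgReadings L M (regClass L M R)) C θ) :
    AveragingLaws (fun k => calDalev L M a ha k ⊗ₖ (1 : Matrix o o ℂ)) (Ecov L M R) (fun k => JpcT L M k ⊗ₖ (1 : Matrix o o ℂ))
      (epsR o d α) (fun k => CdeltaR o d a α (theta0 d α (betaNE3 o C)) * θ ^ k) := by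
  have hθ0 : 0 ≤ θ := (inv_nonneg.mpr (Nat.cast_nonneg L)).trans hθ
  have hα : 0 ≤ α := hreg.nonneg.1
  exact averagingLaws_Ecov_rate L M a ha hα (fun k ν i => norm_transporter_sub_one_le hreg k ν i)
    (thetaC_rate_nonneg L (o := o) (d := d) hα hC hθ0) (sub_nonneg.mpr (Real.one_le_exp (by positivity))) hθ
    (thetaC_rate_le_geom L (o := o) (d := d) hα hC hθ)
    (fun k y μ j r t' ht' => transport_contour_two_level_of_regular_rate L M hreg hC hθ0 hNE3θ k y μ j r t' ht')
    (fun k y μ j _s hs => by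
      haveI := lev_neZero L k
      exact norm_ctr_sub_one_le (lev L k) M hreg.nonneg.1 (fun ν i => norm_transporter_sub_one_le hreg k ν i) y j μ hs)

/-- **AT `θ = L⁻¹` THE PART-2 END IS THE INSTANCE OF RECORD's DATUM**: `AveragingLaws … (epsR o d α) (k ↦ CdeltaR … (theta0 …)·L⁻¹^k)` —
the conclusion of `NE2BalabanWiring.averagingLaws_Ecov_of_regular` at `θ₀ = theta0 d α (βNE3 C)` (`NE2BalabanFinal`'s choice), now with its
numeric binder `hθg` discharged inside. [folklore] -/
theorem averagingLaws_Ecov_of_regular_invRate (hreg : RegularTransporters L M R α β) {C : ℝ} (hC : 0 ≤ C)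
    (hNE3 : LocalRate (bgReadings L M (regClass L M R)) C ((L : ℝ)⁻¹)) :
    AveragingLaws (fun k => calDalev L M a ha k ⊗ₖ (1 : Matrix o o ℂ)) (Ecov L M R) (fun k => JpcT L M k ⊗ₖ (1 : Matrix o o ℂ))
      (epsR o d α) (fun k => CdeltaR o d a α (theta0 d α (betaNE3 o C)) * ((L : ℝ)⁻¹) ^ k) :=
  averagingLaws_Ecov_of_regular_rate L M a ha hreg hC le_rfl hNE3

/-! ## §5 The B3 SLOT of the tier-B perturbation at rate `θ`: `PerturbationLaws` for Bałaban's covariant-averaging summand -/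

/-- **THE COVARIANT-AVERAGING SUMMAND IN THE TARGET SHAPE AT RATE `ρ`** (leaf-01's
`CovariantAveragingBalaban.perturbationLaws_covariantAveraging_balaban` with the transport-error datum `hE` at rate `ρ ≥ L⁻¹`; the free
inner-averaging datum `hB` stays at its rate-`L⁻¹` shape and is MAJORISED, `Cf ≥ 0`):
`PerturbationLaws (Δ_a ⊗ 1) (k ↦ a·n_k^d·(Q_k(R_k)ᴴQ_k(R_k) − (Q_kᴴQ_k) ⊗ 1)) (J ⊗ 1) κ_Q (C₂^Q·ρ^k)` with the SAME
`κ_Q = kappaQ d a a ε` and `C₂^Q = a·C2gram Cst 1 ε (2dCst) CJ Cf Cδ` — the rate-generic Gram core `perturbationLaws_gramPert` +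
`e2gram_le_geom (ρ := ρ)`, the free King defects `2dCst·L⁻¹^k`, `CJ·L⁻¹^k` and `Cf·L⁻¹^k` majorised by `·ρ^k`.
[cite: Balaban1984PropagatorsI, (1.18) p.20, (1.69) p.29, Prop. 1.1 (1.89) p.33; Balaban1985BackgroundPropagators, (3.16) p.393, (3.26) p.395
(where the summand enters); King1986, (2.10) p.653, p.664] [folklore] -/
theorem perturbationLaws_covariantAveraging_balaban_rate {ε Cf Cδ ρ : ℝ} (hε : 0 ≤ ε) (hCf : 0 ≤ Cf) (hρ : ((L : ℝ)⁻¹) ≤ ρ)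
    (hB : AveragingLaws (fun k => calDalev L M a ha k ⊗ₖ (1 : Matrix o o ℂ)) (Bfree (o := o) L M)
      (fun k => JpcT L M k ⊗ₖ (1 : Matrix o o ℂ)) 1 (fun k => Cf * ((L : ℝ)⁻¹) ^ k))
    (hE : AveragingLaws (fun k => calDalev L M a ha k ⊗ₖ (1 : Matrix o o ℂ)) (Ecov L M R)
      (fun k => JpcT L M k ⊗ₖ (1 : Matrix o o ℂ)) ε (fun k => Cδ * ρ ^ k)) :
    PerturbationLaws (fun k => calDalev L M a ha k ⊗ₖ (1 : Matrix o o ℂ))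
      (fun k => (a : ℂ) • ((((lev L k : ℕ) : ℂ) ^ d) • ((QcovLev L M R k)ᴴ * QcovLev L M R k
          - ((QvOp (lev L k) M)ᴴ * QvOp (lev L k) M) ⊗ₖ (1 : Matrix o o ℂ))))
      (fun k => JpcT L M k ⊗ₖ (1 : Matrix o o ℂ)) (kappaQ d a (a : ℂ) ε)
      (fun k => a * C2gram (Cst d a) 1 ε (2 * d * Cst d a) (CJ d a) Cf Cδ * ρ ^ k) := by
  have h := perturbationLaws_gramPert (freeTowerLaws_kron o (freeTowerLaws_king L M a ha)) (opNorm_inv_calDalev_kron_le L M a ha) hB hE (a : ℂ)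
  rw [gramPert_Bfree_Ecov] at h
  have hna : ‖(a : ℂ)‖ = a := by rw [Complex.norm_real, Real.norm_of_nonneg ha.le]
  have hL0 : (0 : ℝ) ≤ (L : ℝ)⁻¹ := inv_nonneg.mpr (Nat.cast_nonneg L)
  have hpow : ∀ k : ℕ, ((L : ℝ)⁻¹) ^ k ≤ ρ ^ k := fun k => pow_le_pow_left₀ hL0 hρ k
  refine perturbationLaws_mono h (le_of_eq ?_) fun k => ?_
  · rw [kappaQ]; ring
  · refine (mul_le_mul_of_nonneg_left (e2gram_le_geom (ρ := ρ) (C₀ := 2 * d * Cst d a) (C₁ := CJ d a) (Cf := Cf) (Cδ := Cδ)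
      (Cst_nonneg d a) zero_le_one hε
      (fun k => mul_le_mul_of_nonneg_left (hpow k) (by positivity [Cst_nonneg d a]))
      (fun k => mul_le_mul_of_nonneg_left (hpow k) (CJ_nonneg d a))
      (fun k => mul_le_mul_of_nonneg_left (hpow k) hCf) (fun k => le_rfl) k) (norm_nonneg _)).trans (le_of_eq ?_)
    rw [hna]; ring

/-- **ROW B8 PART 2, SLOT FORM — BAŁABAN's COVARIANT-AVERAGING SUMMAND `avgPert R` IN THE TARGET SHAPE AT A GENERAL RATE `θ ≥ L⁻¹`, FROM THE
REGULARITY CLASS AND NODE NE3 AT RATE `θ`**: `PerturbationLaws (Δ_a ⊗ 1) (NE2BalabanRoot.avgPert L M a R) (J ⊗ 1) (kappaQ d a a (epsR o d α))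
(k ↦ a·C2gram Cst 1 (epsR o d α) (2dCst) CJ Cst (CdeltaR o d a α (theta0 d α (βNE3 C)))·θ^k)` — EXACTLY the `hP₃` slot that
`NE2BalabanLayer.perturbationLaws_add₃` sums in the instance of record (`NE2BalabanRoot.perturbationLaws_balaban` ∘ `NE2BalabanFinal`), every letter
unchanged, the rate alone moved; the free inner-pairing law DISCHARGED by `LineAveragingPairing.averagingLaws_Bfree` (`Cf = Cst`), `hE` by §4.  Binders
`hreg`, `hC`, `hθ : L⁻¹ ≤ θ`, `hNE3θ` DISPLAYED; NE2 is NOT proved by this. [cite: Balaban1985BackgroundPropagators, (3.26) p.395 (shape)] [folklore] -/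
theorem perturbationLaws_avgPert_of_regular_rate (hreg : RegularTransporters L M R α β) {C θ : ℝ} (hC : 0 ≤ C) (hθ : ((L : ℝ)⁻¹) ≤ θ)
    (hNE3θ : LocalRate (bgReadings L M (regClass L M R)) C θ) :
    PerturbationLaws (fun k => calDalev L M a ha k ⊗ₖ (1 : Matrix o o ℂ)) (avgPert L M a R)
      (fun k => JpcT L M k ⊗ₖ (1 : Matrix o o ℂ)) (kappaQ d a (a : ℂ) (epsR o d α))
      (fun k => a * C2gram (Cst d a) 1 (epsR o d α) (2 * d * Cst d a) (CJ d a) (Cst d a)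
        (CdeltaR o d a α (theta0 d α (betaNE3 o C))) * θ ^ k) :=
  perturbationLaws_covariantAveraging_balaban_rate L M a ha (epsR_nonneg (o := o) (d := d) hreg.nonneg.1) (Cst_nonneg d a) hθ
    (averagingLaws_Bfree L M a ha) (averagingLaws_Ecov_of_regular_rate L M a ha hreg hC hθ hNE3θ)

end Summit.QuantumFields.BalabanUV.T4Continuum.AveragingSummandRate

end
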